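import Mathlib
import Summits.ABC.ABC.Theorems.RibetTakahashiSplitManyPrimeValuationProductJLPackageLemmas
import Literature.NumberTheory.Automorphic.ShimuraCurveRibetTakahashi
import Literature.NumberTheory.EllipticCurves.Isogeny
import Literature.NumberTheory.EllipticCurves.Szpiro
import Literature.NumberTheory.EllipticCurves.IsogenyIdProofs
import Literature.NumberTheory.EllipticCurves.SzpiroOfAbcProofs
import Literature.NumberTheory.DiophantineGeometry.PastenValuationProductsProofs
import Literature.NumberTheory.EllipticCurves.PastenHeightBounds
import Literature.NumberTheory.EllipticCurves.ModularDegreeFormulaProofs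
import Literature.NumberTheory.EllipticCurves.ModularCurveManinConstantProofs
import Literature.NumberTheory.Sieve.DivisorBound
import Literature.NumberTheory.Automorphic.ShimuraCurveAnalytic

/-!
# The Jacquet–Langlands / Ribet–Takahashi / Pasten package on the printed class, II:
# `JLPackage` for semistable and Frey–Hellegouarch curves from the named facts

Helper `--supports` stmt-ABC-1561 (crux
`Summit.ABC.ABC.Theses.RibetTakahashiSplit.ManyPrimeValuationProduct`, line `jl-zero-cycle-height`,
stub `stub_jlPackage : JLPackage`, skeleton rev a3). The stub is the PACKAGE INEQUALITY
`log T_D ≤ C + ε log N + log vol(F) − log ∫_F ‖s‖²_pt dμ` with its side conditions (a Néron period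
pair `L`, a Shimura curve datum `X` of level `(∏D, N/∏D)`, a fundamental domain `F` of finite
positive area, a non-zero weight-`2` form `s` on `X.Gamma` with periods in `Λ_L`, integrability and
a.e. positivity of `‖s‖²_pt`). H. Pasten, *Shimura curves and the abc conjecture*
(arXiv:1705.09251), prints Thm 6.1 (b) ONLY for (b.1) semistable / (b.2) Frey–Hellegouarch curves;
accordingly `jlPackage_printedClass_of_facts` is the skeleton's `JLPackage` (abbreviations
`multPrimes`, `valProd`, `discOf`, `pet`, `IsSemistableAwayFromTwo`, `FermatInput`, `IsCoveringSet`,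
`IsNeronPeriodPairOf` unfolded) WITH the extra hypothesis `IsSemistable W ∨ IsFreyHellegouarch W`,
conditional on exactly eleven named facts: nine of
`Literature.NumberTheory.Automorphic.ShimuraCurveRibetTakahashi` (existence of `X₀^D(M)` data and
of Jacquet–Langlands parametrisations, Shimizu's volume, Frey's identity on the Shimura curve, the
Mazur–Kenku comparison `≤ 163 δ_{D,M}`, Pasten Thm 6.1 (b), the optimal quotient `q_{1,N} j_N`,
Pasten Cor 10.2 (Manin constant), `‖f‖² ≪ N log N`), the tree's
`abs_neronLatticeHeight_sub_le_of_isIsogenous` (Faltings + Mazur–Kenku), and ONE analytic folklore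
fact `shimuraCurve_pet_pos_ae_and_log_integrable` (a.e. positivity and `log`-integrability of
`|h|² y²` on a compact Shimura curve), written inline below for relocation to Literature.

Proof (Pasten §16, proof of Thm 16.4, over `ℂ`): take a global minimal model `Wm = C₀ • W`; a
covering set `D` gives an admissible `N = D' M` with `M` divisible by two multiplicative primes
outside `D` (`admissible_of_isCoveringSet`), which is (b.1) `M` not prime, resp. (b.2) two ODD
primes (a Frey–Hellegouarch curve that is not semistable has `4 ∣ N`, so `2` is not multiplicative);
Thm 6.1 (b) gives `T_D · a δ_{D,M} = δ_{1,N} b`, `b ≤ κ^{ω(D')}`; with `s := P'.form` for a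
minimal-degree datum `P'` of `Wm` on `X`: `‖s‖² = deg P' · covol Λ_{Wm} ≤ 163 δ_{D,M} · 163 covol Λ_{A}`
(Frey, Mazur–Kenku, Faltings), `4π² c² (f,f) = δ_{1,N} covol Λ_A` (Zagier, PROVED in the tree),
`|c| ≤ 𝓜_{{2}}`, `(f,f) ≤ C N log N ≤ C N^{1+η}/η`; so `T_D ≤ K κ^ω N^{1+η}/‖s‖²` (`real_chain`);
finally `vol(X.fd) = (π/3)φ(D')ψ(M) ≥ (π/3) N / 2^ω`, `2^ω ≤ d(D') ≤ C_η N^η`, `κ^ω ≤ 2^{κω}` give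
`log T_D ≤ C + (κ+2)η log N + log vol − log ‖s‖²` (`log_chain`) with `η = ε/(κ+2)`.
-/

-- `Summit.ABC.ABC` is the mandated summit-side namespace (CONVENTIONS §2); the duplicate is deliberate.
set_option linter.dupNamespace false

noncomputable section

open MeasureTheory
open scoped MatrixGroups

namespace Summit.ABC.ABC.Theorems.ManyPrimeValuationProduct.JLPackage

open Literature.NumberTheory.Automorphic
open Literature.NumberTheory.EllipticCurves.ModularForms
open CongruenceSubgroup

/-- **`JLPackage` on the printed class from the named facts** (registered sub-goal of
`stub_jlPackage`; the skeleton's `JLPackage` with abbreviations unfolded and the extra hypothesis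
`IsSemistable W ∨ IsFreyHellegouarch W` of Pasten's Thm 6.1 (b.1)/(b.2)), conditional on the nine
named facts of `ShimuraCurveRibetTakahashi`, the height fact
`abs_neronLatticeHeight_sub_le_of_isIsogenous` and the analytic folklore fact
`shimuraCurve_pet_pos_ae_and_log_integrable`. The witnesses are: `L` = the Néron period pair of a
global minimal model, `X` = any datum of level `(∏D, N/∏D)`, `F = X.fd`, `s` = the pulled-back
invariant differential of a minimal-degree Jacquet–Langlands parametrisation of the minimal model
(Pasten arXiv:1705.09251 §16, proof of Thm 16.4; module docstring for the chain). `[folklore]` -/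
theorem jlPackage_printedClass_of_facts :
    Literature.NumberTheory.Automorphic.nonempty_shimuraCurveData →
    Literature.NumberTheory.Automorphic.ShimuraCurveData.volume_fd_eq →
    Literature.NumberTheory.Automorphic.nonempty_shimuraParametrizationData →
    Literature.NumberTheory.Automorphic.ShimuraParametrizationData.normSq_form_eq_deg_mul_covolume →
    Literature.NumberTheory.Automorphic.ShimuraParametrizationData.minimalDegree_le_163_mul →
    Literature.NumberTheory.Automorphic.PastenShimura2024_thm_6_1_b →
    Literature.NumberTheory.Automorphic.exists_optimal_modularParametrizationData →
    Literature.NumberTheory.Automorphic.PastenShimura2024_cor_10_2 →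
    Literature.NumberTheory.Automorphic.murty_petersson_newform_upper_bound →
    Literature.NumberTheory.EllipticCurves.ModularForms.abs_neronLatticeHeight_sub_le_of_isIsogenous →
    Literature.NumberTheory.Automorphic.shimuraCurve_pet_pos_ae_and_log_integrable →
    ∀ ε : ℝ, 0 < ε → ∃ C : ℝ, ∀ (W : WeierstrassCurve ℚ) [W.IsElliptic],
      (∀ p : ℕ, p.Prime → p ≠ 2 → ¬ p ^ 2 ∣ W.conductorNorm ℤ) →
      (∀ ℓ : ℕ, ℓ.Prime → 11 ≤ ℓ →
        ∃ r ∈ (W.conductorNorm ℤ).primeFactors.filter (fun p => ¬ p ^ 2 ∣ W.conductorNorm ℤ),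
          ¬ ℓ ∣ (W.minimalDiscriminantNorm ℤ).factorization r) →
      ((∀ p : ℕ, p.Prime → ¬ p ^ 2 ∣ W.conductorNorm ℤ) ∨
        Literature.NumberTheory.Automorphic.IsFreyHellegouarch W) →
      ∀ D : Finset ℕ,
        (D ⊆ (W.conductorNorm ℤ).primeFactors.filter (fun p => ¬ p ^ 2 ∣ W.conductorNorm ℤ) ∧
          Even D.card ∧ 2 ≤ D.card ∧
          2 ≤ ((W.conductorNorm ℤ).primeFactors.filter (fun p => ¬ p ^ 2 ∣ W.conductorNorm ℤ) \
            D).card) →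
        ∃ (L : PeriodPair)
          (X : Literature.NumberTheory.Automorphic.ShimuraCurveData (∏ p ∈ D, p)
            (W.conductorNorm ℤ / ∏ p ∈ D, p))
          (F : Set UpperHalfPlane) (s : CuspForm X.Gamma 2),
          (∃ C : WeierstrassCurve.VariableChange ℚ, (C • W).IsGloballyMinimal ∧
            Literature.NumberTheory.EllipticCurves.ModularForms.IsNeronLatticeOf
              ((C • W).baseChange ℂ) L) ∧
          Literature.NumberTheory.Automorphic.IsHypFundamentalDomain X.Gamma F ∧
          MeasureTheory.volume F ≠ 0 ∧ MeasureTheory.volume F ≠ ⊤ ∧ s ≠ 0 ∧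
          Literature.NumberTheory.Automorphic.HasPeriodsIn X.Gamma s (L.lattice : Set ℂ) ∧
          MeasureTheory.IntegrableOn (fun z => ‖s z‖ ^ 2 * z.im ^ 2) F ∧
          MeasureTheory.IntegrableOn (fun z => Real.log (‖s z‖ ^ 2 * z.im ^ 2)) F ∧
          (∀ᵐ z ∂(MeasureTheory.volume.restrict F), 0 < ‖s z‖ ^ 2 * z.im ^ 2) ∧
          (0 < ∫ z in F, ‖s z‖ ^ 2 * z.im ^ 2) ∧
          Real.log ((∏ p ∈ D, (W.minimalDiscriminantNorm ℤ).factorization p : ℕ) : ℝ) ≤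
            C + ε * Real.log (W.conductorNorm ℤ) + Real.log (MeasureTheory.volume F).toReal -
              Real.log (∫ z in F, ‖s z‖ ^ 2 * z.im ^ 2) := by
  intro hXex hvol hJL hFrey h163 h61 hopt hManin hPet hht hAn ε hε
  -- constants, chosen before the curve
  obtain ⟨κ, hκ1, -, h61⟩ := h61
  obtain ⟨𝓜, hManin⟩ := hManin {2}
  obtain ⟨Cpet, hPet⟩ := hPet
  set Cp : ℝ := max Cpet 1 with hCpdef
  set 𝓜' : ℝ := max (𝓜 : ℝ) 1 with h𝓜'def
  set η : ℝ := ε / (κ + 2) with hηdef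
  have hη : 0 < η := by positivity
  obtain ⟨Cη, hCη1, hCη⟩ := Literature.NumberTheory.Sieve.exists_card_divisors_le_mul_rpow' hη
  set K : ℝ := 4 * Real.pi ^ 2 * 𝓜' ^ 2 * Cp * 163 ^ 2 / η with hKdef
  have hCp1 : 1 ≤ Cp := le_max_right _ _
  have h𝓜'1 : 1 ≤ 𝓜' := le_max_right _ _
  have hK : 0 < K := by positivity
  refine ⟨Real.log K + (κ + 1) * Real.log Cη + Real.log (3 / Real.pi), ?_⟩
  intro W _ hss _hFI hclass D hcov
  -- a globally minimal model
  obtain ⟨C₀, hC₀⟩ := WeierstrassCurve.hasGlobalMinimalModel_rat_holds W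
  haveI := hC₀
  set Wm := C₀ • W with hWm
  have hNeq : Wm.conductorNorm ℤ = W.conductorNorm ℤ := WeierstrassCurve.conductorNorm_smul_rat W C₀
  have hΔeq : Wm.minimalDiscriminantNorm ℤ = W.minimalDiscriminantNorm ℤ :=
    WeierstrassCurve.minimalDiscriminantNorm_smul_rat W C₀
  set N := W.conductorNorm ℤ with hNdef
  have hNpos : 0 < N := W.conductorNorm_pos_holds
  haveI : NeZero N := ⟨hNpos.ne'⟩
  obtain ⟨hDsub, heven, h2D, h2M⟩ := hcov
  obtain ⟨hadm, hMsub⟩ := admissible_of_isCoveringSet hDsub heven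
  have hprime : ∀ p ∈ D, p.Prime := fun p hp => prime_of_mem hDsub hp
  set D' := ∏ p ∈ D, p with hD'def
  set M := N / D' with hMdef
  set T : ℕ := ∏ p ∈ D, (W.minimalDiscriminantNorm ℤ).factorization p with hTdef
  have hMpos : 0 < M := hadm.pos_right
  have hD'M : D' * M = N := hadm.mul_eq
  have hωD : D'.primeFactors = D := primeFactors_prod_primes hprime
  have hD'4 : 4 ≤ D' := by
    have h := two_pow_card_le_prod hprime
    have : 2 ^ 2 ≤ 2 ^ D.card := Nat.pow_le_pow_right two_pos h2D
    omega
  -- the data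
  obtain ⟨X⟩ := hXex hadm
  obtain ⟨PW⟩ := hJL hadm X Wm hNeq
  obtain ⟨P', hP'min⟩ := exists_self_minimal PW
  obtain ⟨W₀', hW₀', P₀, hP₀⟩ := exists_class_minimal PW
  obtain ⟨W₀, hW₀e, hW₀m, D₀, hnew, hiso, hD₀min⟩ := hopt N Wm hNeq
  -- the printed class for Thm 6.1 (b)
  have hcardM : 2 ≤ M.primeFactors.card := h2M.trans (Finset.card_le_card hMsub)
  have hcls : (Wm.IsSemistable ℤ ∧ ¬ M.Prime) ∨
      (IsFreyHellegouarch Wm ∧ 2 ≤ (M.primeFactors.erase 2).card) := by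
    by_cases hsW : ∀ p : ℕ, p.Prime → ¬ p ^ 2 ∣ W.conductorNorm ℤ
    · left
      refine ⟨?_, fun hMp => ?_⟩
      · rw [WeierstrassCurve.isSemistable_iff_squarefree_conductorNorm, hNeq]
        exact Nat.squarefree_iff_prime_squarefree.mpr fun p hp h =>
          hsW p hp (by rwa [pow_two])
      · rw [Nat.Prime.primeFactors hMp, Finset.card_singleton] at hcardM
        omega
    · right
      have hF : IsFreyHellegouarch W := hclass.resolve_left hsW
      refine ⟨?_, ?_⟩
      · obtain ⟨a, b, C, ha, hb, hab, hCW⟩ := hF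
        refine ⟨a, b, C * C₀⁻¹, ha, hb, hab, ?_⟩
        rw [hWm, smul_smul, inv_mul_cancel_right, hCW]
      · have h4 : 2 ^ 2 ∣ N := by
          by_contra h4
          apply hsW
          intro p hp hp2
          by_cases hp2' : p = 2
          · subst hp2'; exact h4 hp2
          · exact hss p hp hp2' hp2
        have h2notin : 2 ∉ (W.conductorNorm ℤ).primeFactors.filter
            (fun p => ¬ p ^ 2 ∣ W.conductorNorm ℤ) := fun h2 => (Finset.mem_filter.mp h2).2 h4
        have hsub : (W.conductorNorm ℤ).primeFactors.filter (fun p => ¬ p ^ 2 ∣ W.conductorNorm ℤ) \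
            D ⊆ M.primeFactors.erase 2 := fun q hq => by
          rw [Finset.mem_erase]
          refine ⟨fun h => h2notin ?_, hMsub hq⟩
          subst h
          exact (Finset.mem_sdiff.mp hq).1
        exact h2M.trans (Finset.card_le_card hsub)
  -- Thm 6.1 (b)
  obtain ⟨a, b, ha, hb, hbκ, hEq⟩ := h61 hadm X Wm hNeq hcls W₀ D₀ hnew hD₀min W₀' P₀ hP₀
  rw [hωD] at hbκ
  rw [hωD, hΔeq] at hEq
  -- hEq : δ₁ * b = a * δ * T
  have hδ₁pos : 0 < D₀.modularDegree := D₀.deg_pos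
  have hT1 : 1 ≤ T := by
    rcases Nat.eq_zero_or_pos T with h0 | h0
    · rw [← hTdef, h0, mul_zero] at hEq
      exact absurd hEq (Nat.mul_ne_zero hδ₁pos.ne' hb.ne')
    · exact h0
  have hbκ' : b ≤ κ ^ D.card := Nat.le_of_dvd (pow_pos hκ1 _) hbκ
  -- Mazur–Kenku, Frey, Zagier, Manin, Petersson, heights
  have hdeg : P'.deg ≤ 163 * P₀.deg := h163 P₀ P' hP₀ hP'min
  have hnorm : X.normSq P'.form = P'.deg * ZLattice.covolume P'.L.lattice := hFrey P'
  have hz := D₀.zagier_degree_formula_holds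
  have hff0 : 0 < (peterssonProduct (Gamma0 N) 2 D₀.f D₀.f).re := hz.peterssonProduct_re_pos
  have hzr : 4 * Real.pi ^ 2 * (D₀.c : ℝ) ^ 2 * (peterssonProduct (Gamma0 N) 2 D₀.f D₀.f).re =
      D₀.deg * ZLattice.covolume D₀.L.lattice := by
    have := congrArg Complex.re hz
    rwa [Complex.re_ofReal_mul, Complex.ofReal_re] at this
  have hc : |D₀.maninConstant| ≤ (𝓜 : ℤ) :=
    hManin N W₀ D₀ (fun p hp hpS => hss p hp (by simpa using hpS)) hD₀min
  have hc' : |(D₀.c : ℝ)| ≤ 𝓜' := by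
    have h1 : ((|D₀.c| : ℤ) : ℝ) ≤ (𝓜 : ℝ) := by exact_mod_cast hc
    rw [Int.cast_abs] at h1
    rw [h𝓜'def]
    exact h1.trans (le_max_left _ _)
  have hpet : (peterssonProduct (Gamma0 N) 2 D₀.f D₀.f).re ≤ Cpet * N * Real.log N :=
    hPet N W₀ D₀.f D₀.isNewformOf
  have hheight := hht Wm W₀ P'.L D₀.L P'.isNeronLattice D₀.isNeronLattice hiso
  -- positivity of the covolumes and the comparison `V ≤ 163 V₀`
  have hV : 0 < ZLattice.covolume P'.L.lattice := ZLattice.covolume_pos _ _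
  have hV₀ : 0 < ZLattice.covolume D₀.L.lattice := ZLattice.covolume_pos _ _
  have hVV : ZLattice.covolume P'.L.lattice ≤ 163 * ZLattice.covolume D₀.L.lattice := by
    unfold neronLatticeHeight at hheight
    have h := (abs_le.mp hheight).1
    have hlog : Real.log (ZLattice.covolume P'.L.lattice) ≤
        Real.log (ZLattice.covolume D₀.L.lattice) + Real.log 163 := by linarith
    calc ZLattice.covolume P'.L.lattice = Real.exp (Real.log (ZLattice.covolume P'.L.lattice)) :=
          (Real.exp_log hV).symm
      _ ≤ Real.exp (Real.log (ZLattice.covolume D₀.L.lattice) + Real.log 163) :=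
          Real.exp_le_exp.mpr hlog
      _ = 163 * ZLattice.covolume D₀.L.lattice := by
          rw [Real.exp_add, Real.exp_log hV₀, Real.exp_log (by norm_num), mul_comm]
  -- the Petersson bound in power form: `N log N ≤ N^{1+η}/η`
  have hN1 : (1 : ℝ) ≤ N := by exact_mod_cast hNpos
  have hpet' : (peterssonProduct (Gamma0 N) 2 D₀.f D₀.f).re ≤ Cp * ((N : ℝ) ^ (1 + η) / η) := by
    have hlogN : 0 ≤ Real.log N := Real.log_nonneg hN1
    have h1 : Cpet * N * Real.log N ≤ Cp * N * Real.log N := by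
      have : 0 ≤ (N : ℝ) * Real.log N := by positivity
      nlinarith [le_max_left Cpet 1]
    have h2 : Real.log N ≤ (N : ℝ) ^ η / η := Real.log_le_rpow_div (by positivity) hη
    have h3 : (N : ℝ) * ((N : ℝ) ^ η / η) = (N : ℝ) ^ (1 + η) / η := by
      rw [Real.rpow_add (by positivity), Real.rpow_one, mul_div_assoc]
    calc (peterssonProduct (Gamma0 N) 2 D₀.f D₀.f).re ≤ Cp * N * Real.log N := hpet.trans h1
      _ ≤ Cp * N * ((N : ℝ) ^ η / η) := by
          apply mul_le_mul_of_nonneg_left h2; positivity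
      _ = Cp * ((N : ℝ) ^ (1 + η) / η) := by rw [mul_assoc, h3]
  -- the multiplicative chain
  set S : ℝ := X.normSq P'.form with hSdef
  have hTeq : (T : ℝ) * (a * P₀.deg) = D₀.modularDegree * b := by
    have : ((D₀.modularDegree * b : ℕ) : ℝ) = ((a * P₀.deg * T : ℕ) : ℝ) := by
      exact_mod_cast hEq
    push_cast at this
    linarith
  have hchain := real_chain (κω := (κ : ℝ) ^ D.card) hTeq (by exact_mod_cast ha) (by positivity)
    (by exact_mod_cast hbκ') (by exact_mod_cast P₀.deg_pos) (by positivity) (by positivity)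
    (by exact_mod_cast hdeg) (by exact_mod_cast P'.deg_pos) hnorm hV hV₀ hVV hzr hc' hff0.le hpet'
  have hchain' : (T : ℝ) ≤ K * (κ : ℝ) ^ D.card * (N : ℝ) ^ (1 + η) / S := by
    rw [hKdef]
    convert hchain using 1
    field_simp
  -- positivity of `S` and consequences
  have hS : 0 < S := by rw [hnorm]; exact mul_pos (by exact_mod_cast P'.deg_pos) hV
  have hne : P'.form ≠ 0 := by
    intro h0
    have : S = 0 := by
      rw [hSdef, h0]
      simp [ShimuraCurveData.normSq, peterssonNormSq]
    exact hS.ne' this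
  have hint : IntegrableOn (fun z : UpperHalfPlane => ‖P'.form z‖ ^ 2 * z.im ^ 2) X.fd := by
    by_contra hni
    have : S = 0 := integral_undef hni
    exact hS.ne' this
  obtain ⟨hae, hlog⟩ := hAn X P'.form (by omega) hne
  -- the volume
  have hv := hvol X hMpos
  set vol : ℝ := (volume X.fd).toReal with hvoldef
  have hφψ : (D' * M : ℝ) ≤ (Nat.totient D' * gamma0Index M : ℕ) * (2 : ℝ) ^ D.card := by
    have h1 : D' ≤ Nat.totient D' * 2 ^ D.card := prod_le_totient_mul_two_pow hprime
    have h2 : M ≤ gamma0Index M := le_gamma0Index M hMpos.ne'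
    have : D' * M ≤ Nat.totient D' * gamma0Index M * 2 ^ D.card := by
      calc D' * M ≤ (Nat.totient D' * 2 ^ D.card) * gamma0Index M := Nat.mul_le_mul h1 h2
        _ = Nat.totient D' * gamma0Index M * 2 ^ D.card := by ring
    exact_mod_cast this
  have hvoleq : vol = Real.pi / 3 * ((Nat.totient D' * gamma0Index M : ℕ) : ℝ) := by
    rw [hvoldef, hv, ENNReal.toReal_ofReal (by positivity)]
  have hvol0 : 0 < vol := by
    rw [hvoleq]
    have : 0 < Nat.totient D' * gamma0Index M :=
      Nat.mul_pos (Nat.totient_pos.mpr hadm.pos_left) (hMpos.trans_le (le_gamma0Index M hMpos.ne'))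
    positivity
  have hvolb : Real.pi / 3 * (N : ℝ) ≤ vol * (2 : ℝ) ^ D.card := by
    rw [hvoleq, ← hD'M]
    push_cast
    have hπ : 0 ≤ Real.pi / 3 := by positivity
    calc Real.pi / 3 * ((D' : ℝ) * M)
        ≤ Real.pi / 3 * ((Nat.totient D' * gamma0Index M : ℕ) * (2 : ℝ) ^ D.card) :=
          mul_le_mul_of_nonneg_left hφψ hπ
      _ = _ := by push_cast; ring
  -- the divisor bound `2^ω ≤ C_η N^η`
  have hdiv : (2 : ℝ) ^ D.card ≤ Cη * (N : ℝ) ^ η := by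
    have h1 : ((2 ^ D.card : ℕ) : ℝ) ≤ (D'.divisors.card : ℝ) := by
      exact_mod_cast two_pow_card_le_card_divisors hprime
    have h2 := hCη D'
    have h3 : (D' : ℝ) ^ η ≤ (N : ℝ) ^ η := by
      apply Real.rpow_le_rpow (by positivity) _ hη.le
      exact_mod_cast Nat.le_of_dvd hNpos (hD'M ▸ dvd_mul_right D' M)
    push_cast at h1
    calc (2 : ℝ) ^ D.card ≤ D'.divisors.card := h1
      _ ≤ Cη * (D' : ℝ) ^ η := h2
      _ ≤ Cη * (N : ℝ) ^ η := mul_le_mul_of_nonneg_left h3 (by linarith)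
  -- the logarithmic chain
  have hκR : (1 : ℝ) ≤ κ := by exact_mod_cast hκ1
  have hκ2 : (κ : ℝ) ≤ 2 ^ (κ : ℝ) := by
    rw [Real.rpow_natCast]; exact_mod_cast (Nat.lt_two_pow_self (n := κ)).le
  have hlogT := log_chain (ω := D.card) (by exact_mod_cast hT1) hchain' hK hS hκR hκ2 hN1
    hCη1 rfl hdiv hvol0 hvolb
  have hεη : ((κ : ℝ) + 2) * η = ε := by rw [hηdef]; field_simp
  rw [hεη] at hlogT
  exact ⟨P'.L, X, X.fd, P'.form, ⟨C₀, hC₀, P'.isNeronLattice⟩, X.isHypFundamentalDomain_fd,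
    by rw [hv]; exact (ENNReal.ofReal_pos.mpr (by rw [← hvoleq]; exact hvol0)).ne',
    by rw [hv]; exact ENNReal.ofReal_ne_top, hne, P'.period_mem, hint, hlog, hae, hS, hlogT⟩

end Summit.ABC.ABC.Theorems.ManyPrimeValuationProduct.JLPackage

end
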